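import Literature.NumberTheory.Automorphic.LocalPiSchwartzBruhatFourier
import Literature.NumberTheory.Automorphic.AdelicSchwartzBruhatTensor
import Literature.NumberTheory.Automorphic.AdelicTensorStripping
import Literature.NumberTheory.Automorphic.SchwartzBruhatCosetIndicator
import HarnessLib

/-!
# A finite place is exact: `𝒮(K^ι) = 𝒮(K^{ι₁}) ⊗ 𝒮(K^{ι₂})` along a splitting `ι₁ ⊕ ι₂ ≃ ι` of the coordinates

Topic `NumberTheory/Automorphic`; namespace `Literature.NumberTheory.Automorphic`. KERNEL MATHEMATICS ONLY: every
declaration below is proved; no `def … : Prop` record, no cited hypothesis, no `sorry`. The single-place twin of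
the tree's `FiniteAdeleSchwartzBruhatDirectSum` (`𝒮((𝔸_K^∞)^{ι₁ ⊕ ι₂}) = 𝒮((𝔸_K^∞)^{ι₁}) ⊗ 𝒮((𝔸_K^∞)^{ι₂})`).

For a non-archimedean local field `K`, index types `ι₁, ι₂, ι` and an enumeration `e : ι₁ ⊕ ι₂ ≃ ι` of the
coordinates (so that `K^ι = K^{ι₁} × K^{ι₂}`; the case of record is `ι = Fin (n + n)`, `e = finSumFinEquiv`, the
coordinates of a doubled space `𝕎 ⊕ 𝕎⁻`), the Schwartz–Bruhat space `𝒮(K^ι)` (locally constant compactly supported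
functions, the tree's `SchwartzBruhat (ι → K)` of `TateLocalFactors`) is the ALGEBRAIC tensor product of the two
factors [WeilBNT1967, Chap. VII §2, Prop. 2; Bruhat1961]:

* §1 the coordinate maps `resL e v = v|ι₁`, `resR e v = v|ι₂`, `glue e a b = a ⊔ b` along `e` (pure bookkeeping);
* §2 the multiplication map `sumMapSB K e : 𝒮(K^{ι₁}) ⊗ 𝒮(K^{ι₂}) →ₗ ((ι → K) → ℂ)`, `f₁ ⊗ f₂ ↦ (v ↦ f₁(v|ι₁) f₂(v|ι₂))`,
  INJECTIVE (linear disjointness of function tensors over a field, tree `TensorFunctions.mulMap_injective`) with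
  range EXACTLY `𝒮(K^ι)`: a Schwartz–Bruhat function is a finite combination of indicators of cosets of a box
  `(𝔭^N)^ι` (tree `exists_finset_eq_sum_const_mul_indicator_pi`, [WeilBNT1967, VII §2 Prop. 2]) and
  `𝟙_{a + (𝔭^N)^ι} = 𝟙_{a|ι₁ + (𝔭^N)^{ι₁}} ⊠ 𝟙_{a|ι₂ + (𝔭^N)^{ι₂}}`;
* §3 the isomorphism `sumEquivSB K e : 𝒮(K^{ι₁}) ⊗ 𝒮(K^{ι₂}) ≃ₗ[ℂ] 𝒮(K^ι)`, the products `boxSB K e f₁ f₂ = f₁ ⊠ f₂`,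
  extensionality on products (`linearMap_ext_boxSB`), `⊠ f₂`-cancellation (`boxSB_left_cancel`);
* §4 the product operators `sumEndSB K e B₁ B₂ = B₁ ⊠ B₂` (`sumEndSB_boxSB`, functoriality) — so that `B₁ ⊠ 1` IS a
  linear endomorphism of `𝒮(K^ι)` for an arbitrary linear `B₁` of `𝒮(K^{ι₁})`.

This is the function-space input of the LOCAL sum-stripping of implementers (`HeisenbergGroup/MetaplecticSumStripping`:
an implementer of `g₁ ⊕ 1` on `𝒮(K^ι)` is `M₁ ⊠ 1`, [MoeglinVignerasWaldspurger1987, Chap. 2 II.1 Rem. (6)]), hence of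
the local «undoubling» step of [GelbartRogawski1991, §3.1 Prop. 3.1.1] / [Kudla1994, Thm. 3.1].

## References

* [WeilBNT1967] A. Weil, *Basic Number Theory* (1967), Chap. VII §2, Prop. 2 (standard functions on `K^ι`).
* [Bruhat1961] F. Bruhat, *Distributions sur un groupe localement compact …*, Bull. SMF 89 (1961), §9.
* [MoeglinVignerasWaldspurger1987] C. Mœglin, M.-F. Vignéras, J.-L. Waldspurger, LNM 1291 (1987), Chap. 2 II.1 Rem. (6).

## Provenance

LEAN-IN-TREE rule, pub-hodgecm stage-1 cell, seat GR-1 ≡ own-real34 (local undoubling of the cite-free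
[GelbartRogawski1991, Prop. 3.1.1] package: the `FinLocalSplittings` of an undoubled unitary group).
-/

set_option autoImplicit false

noncomputable section

open scoped TensorProduct Pointwise

namespace Literature.NumberTheory.Automorphic

/-! ## §1 Coordinates along `e : ι₁ ⊕ ι₂ ≃ ι` -/

section Glue

variable {X : Type*} {ι₁ ι₂ ι : Type*} (e : ι₁ ⊕ ι₂ ≃ ι)

/-- the `ι₁`-coordinates of `v ∈ X^ι` along `e`: `(v|ι₁)_i = v_{e(inl i)}`. [cite: Kudla1984, §1] -/
def resL (v : ι → X) : ι₁ → X := fun i => v (e (Sum.inl i))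

/-- the `ι₂`-coordinates of `v ∈ X^ι` along `e`: `(v|ι₂)_j = v_{e(inr j)}`. [cite: Kudla1984, §1] -/
def resR (v : ι → X) : ι₂ → X := fun j => v (e (Sum.inr j))

/-- gluing `a ∈ X^{ι₁}`, `b ∈ X^{ι₂}` to `a ⊔ b ∈ X^ι` along `e`. [cite: Kudla1984, §1] -/
def glue (a : ι₁ → X) (b : ι₂ → X) : ι → X := fun k => Sum.elim a b (e.symm k)

/-- formula. [cite: Kudla1984, §1] -/
@[simp] theorem resL_apply (v : ι → X) (i : ι₁) : resL e v i = v (e (Sum.inl i)) := rfl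

/-- formula. [cite: Kudla1984, §1] -/
@[simp] theorem resR_apply (v : ι → X) (j : ι₂) : resR e v j = v (e (Sum.inr j)) := rfl

/-- `(a ⊔ b)_{e(inl i)} = a_i`. [cite: Kudla1984, §1] -/
@[simp] theorem glue_apply_inl (a : ι₁ → X) (b : ι₂ → X) (i : ι₁) : glue e a b (e (Sum.inl i)) = a i := by
  simp [glue]

/-- `(a ⊔ b)_{e(inr j)} = b_j`. [cite: Kudla1984, §1] -/
@[simp] theorem glue_apply_inr (a : ι₁ → X) (b : ι₂ → X) (j : ι₂) : glue e a b (e (Sum.inr j)) = b j := by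
  simp [glue]

/-- `(a ⊔ b)|ι₁ = a`. [cite: Kudla1984, §1] -/
@[simp] theorem resL_glue (a : ι₁ → X) (b : ι₂ → X) : resL e (glue e a b) = a := by
  funext i; simp

/-- `(a ⊔ b)|ι₂ = b`. [cite: Kudla1984, §1] -/
@[simp] theorem resR_glue (a : ι₁ → X) (b : ι₂ → X) : resR e (glue e a b) = b := by
  funext j; simp

/-- `v = v|ι₁ ⊔ v|ι₂`. [cite: Kudla1984, §1] -/
@[simp] theorem glue_resL_resR (v : ι → X) : glue e (resL e v) (resR e v) = v := by
  funext k
  obtain ⟨s, rfl⟩ := e.surjective k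
  rcases s with i | j
  · simp
  · simp

/-- the splitting `v ↦ (v|ι₁, v|ι₂)` is surjective. [cite: Kudla1984, §1] -/
theorem surjective_resL_resR : Function.Surjective fun v : ι → X => (resL e v, resR e v) :=
  fun p => ⟨glue e p.1 p.2, by simp⟩

/-- a coordinatewise statement splits along `e`. [cite: Kudla1984, §1] -/
theorem forall_coord_iff {Q : ι → X → Prop} (v : ι → X) :
    (∀ k, Q k (v k)) ↔ (∀ i, Q (e (Sum.inl i)) (resL e v i)) ∧ ∀ j, Q (e (Sum.inr j)) (resR e v j) := by
  constructor
  · exact fun h => ⟨fun i => h _, fun j => h _⟩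
  · rintro ⟨h₁, h₂⟩ k
    obtain ⟨s, rfl⟩ := e.surjective k
    rcases s with i | j
    · exact h₁ i
    · exact h₂ j

section AddGroup

variable [AddGroup X]

/-- `(v + w)|ι₁ = v|ι₁ + w|ι₁`. [cite: Kudla1984, §1] -/
@[simp] theorem resL_add (v w : ι → X) : resL e (v + w) = resL e v + resL e w := rfl

/-- `(v + w)|ι₂ = v|ι₂ + w|ι₂`. [cite: Kudla1984, §1] -/
@[simp] theorem resR_add (v w : ι → X) : resR e (v + w) = resR e v + resR e w := rfl

/-- `(-v)|ι₁ = -(v|ι₁)`. [cite: Kudla1984, §1] -/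
@[simp] theorem resL_neg (v : ι → X) : resL e (-v) = -resL e v := rfl

/-- `(-v)|ι₂ = -(v|ι₂)`. [cite: Kudla1984, §1] -/
@[simp] theorem resR_neg (v : ι → X) : resR e (-v) = -resR e v := rfl

/-- `(v - w)|ι₁ = v|ι₁ - w|ι₁`. [cite: Kudla1984, §1] -/
@[simp] theorem resL_sub (v w : ι → X) : resL e (v - w) = resL e v - resL e w := rfl

/-- `(v - w)|ι₂ = v|ι₂ - w|ι₂`. [cite: Kudla1984, §1] -/
@[simp] theorem resR_sub (v w : ι → X) : resR e (v - w) = resR e v - resR e w := rfl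

/-- `0|ι₁ = 0`. [cite: Kudla1984, §1] -/
@[simp] theorem resL_zero : resL e (0 : ι → X) = 0 := rfl

/-- `0|ι₂ = 0`. [cite: Kudla1984, §1] -/
@[simp] theorem resR_zero : resR e (0 : ι → X) = 0 := rfl

/-- `(a ⊔ b) + (a' ⊔ b') = (a + a') ⊔ (b + b')`. [cite: Kudla1984, §1] -/
theorem glue_add (a a' : ι₁ → X) (b b' : ι₂ → X) : glue e a b + glue e a' b' = glue e (a + a') (b + b') := by
  funext k
  obtain ⟨s, rfl⟩ := e.surjective k
  rcases s with i | j
  · simp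
  · simp

/-- `0 ⊔ 0 = 0`. [cite: Kudla1984, §1] -/
@[simp] theorem glue_zero : glue e (0 : ι₁ → X) (0 : ι₂ → X) = 0 := by
  funext k
  obtain ⟨s, rfl⟩ := e.surjective k
  rcases s with i | j
  · simp
  · simp

end AddGroup

section Topology

variable [TopologicalSpace X]

/-- `v ↦ v|ι₁` is continuous. [cite: Kudla1984, §1] -/
theorem continuous_resL : Continuous (resL (X := X) e) :=
  continuous_pi fun i => continuous_apply (e (Sum.inl i))

/-- `v ↦ v|ι₂` is continuous. [cite: Kudla1984, §1] -/
theorem continuous_resR : Continuous (resR (X := X) e) :=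
  continuous_pi fun j => continuous_apply (e (Sum.inr j))

/-- `(a, b) ↦ a ⊔ b` is continuous. [cite: Kudla1984, §1] -/
theorem continuous_glue : Continuous fun p : (ι₁ → X) × (ι₂ → X) => glue e p.1 p.2 := by
  refine continuous_pi fun k => ?_
  obtain ⟨s, rfl⟩ := e.surjective k
  rcases s with i | j
  · have : (fun p : (ι₁ → X) × (ι₂ → X) => glue e p.1 p.2 (e (Sum.inl i))) = fun p => p.1 i :=
      funext fun p => glue_apply_inl e p.1 p.2 i
    rw [this]; exact (continuous_apply i).comp continuous_fst
  · have : (fun p : (ι₁ → X) × (ι₂ → X) => glue e p.1 p.2 (e (Sum.inr j))) = fun p => p.2 j :=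
      funext fun p => glue_apply_inr e p.1 p.2 j
    rw [this]; exact (continuous_apply j).comp continuous_snd

end Topology

end Glue

/-! ## §2 The multiplication map `𝒮(K^{ι₁}) ⊗ 𝒮(K^{ι₂}) → (K^ι → ℂ)`, its injectivity and its range -/

section Mul

variable (K : Type*) [TopologicalSpace K] {ι₁ ι₂ ι : Type*} (e : ι₁ ⊕ ι₂ ≃ ι)

/-- **the multiplication map** `f₁ ⊗ f₂ ↦ (v ↦ f₁(v|ι₁) · f₂(v|ι₂))` from the algebraic tensor product of the
Schwartz–Bruhat spaces of the factors to functions on `K^ι`. [cite: WeilBNT1967, Chap. VII §2, Prop. 2] -/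
def sumMapSB : SchwartzBruhat (ι₁ → K) ⊗[ℂ] SchwartzBruhat (ι₂ → K) →ₗ[ℂ] ((ι → K) → ℂ) :=
  LinearMap.funLeft ℂ ℂ (fun v : ι → K => (resL e v, resR e v)) ∘ₗ
    TensorFunctions.mulMap (SchwartzBruhat (ι₁ → K)).subtype (SchwartzBruhat (ι₂ → K)).subtype

/-- on pure tensors. [cite: WeilBNT1967, Chap. VII §2, Prop. 2] -/
@[simp] theorem sumMapSB_tmul (f₁ : SchwartzBruhat (ι₁ → K)) (f₂ : SchwartzBruhat (ι₂ → K)) :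
    sumMapSB K e (f₁ ⊗ₜ f₂) = fun v =>
      (f₁ : (ι₁ → K) → ℂ) (resL e v) * (f₂ : (ι₂ → K) → ℂ) (resR e v) := by
  simp only [sumMapSB, LinearMap.comp_apply, TensorFunctions.mulMap_tmul]
  rfl

/-- **injectivity** of the multiplication map (linear disjointness over a field).
[cite: WeilBNT1967, Chap. VII §2, Prop. 2] -/
theorem sumMapSB_injective : Function.Injective (sumMapSB K e) := by
  unfold sumMapSB
  rw [LinearMap.coe_comp]
  exact (LinearMap.funLeft_injective_of_surjective ℂ ℂ _ (surjective_resL_resR e)).comp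
    (TensorFunctions.mulMap_injective _ _ (SchwartzBruhat (ι₁ → K)).injective_subtype
      (SchwartzBruhat (ι₂ → K)).injective_subtype)

variable {K}

/-- **a product of Schwartz–Bruhat functions in separate variables is Schwartz–Bruhat** on `K^ι`.
[cite: WeilBNT1967, Chap. VII §2, Prop. 2] -/
theorem mul_resL_resR_mem_schwartzBruhat {f₁ : (ι₁ → K) → ℂ} {f₂ : (ι₂ → K) → ℂ}
    (hf₁ : f₁ ∈ SchwartzBruhat (ι₁ → K)) (hf₂ : f₂ ∈ SchwartzBruhat (ι₂ → K)) :
    (fun v : ι → K => f₁ (resL e v) * f₂ (resR e v)) ∈ SchwartzBruhat (ι → K) := by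
  obtain ⟨h₁lc, h₁cs⟩ := mem_schwartzBruhat_iff.1 hf₁
  obtain ⟨h₂lc, h₂cs⟩ := mem_schwartzBruhat_iff.1 hf₂
  refine mem_schwartzBruhat_iff.2
    ⟨(h₁lc.comp_continuous (continuous_resL e)).mul (h₂lc.comp_continuous (continuous_resR e)), ?_⟩
  -- compact support: the support lies in `{v | v|ι₁ ∈ tsupport f₁, v|ι₂ ∈ tsupport f₂}`, the (closed) image of
  -- the compact `tsupport f₁ × tsupport f₂` under gluing
  set S : Set (ι → K) := (fun v : ι → K => (resL e v, resR e v)) ⁻¹' (tsupport f₁ ×ˢ tsupport f₂) with hS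
  have hSc : IsClosed S :=
    ((isClosed_tsupport f₁).prod (isClosed_tsupport f₂)).preimage ((continuous_resL e).prodMk (continuous_resR e))
  have hSeq : S = (fun p : (ι₁ → K) × (ι₂ → K) => glue e p.1 p.2) '' (tsupport f₁ ×ˢ tsupport f₂) := by
    ext v
    constructor
    · exact fun hv => ⟨(resL e v, resR e v), hv, glue_resL_resR e v⟩
    · rintro ⟨p, hp, rfl⟩
      simpa [hS] using hp
  have hK : IsCompact S := by
    rw [hSeq]; exact (h₁cs.isCompact.prod h₂cs.isCompact).image (continuous_glue e)
  refine HasCompactSupport.intro' hK hSc fun v hv => ?_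
  by_contra hne
  exact hv ⟨subset_tsupport _ (left_ne_zero_of_mul hne), subset_tsupport _ (right_ne_zero_of_mul hne)⟩

/-- the range of the multiplication map lies in `𝒮(K^ι)`. [cite: WeilBNT1967, Chap. VII §2, Prop. 2] -/
theorem range_sumMapSB_le : LinearMap.range (sumMapSB K e) ≤ SchwartzBruhat (ι → K) := by
  rintro _ ⟨t, rfl⟩
  induction t using TensorProduct.induction_on with
  | zero => rw [map_zero]; exact zero_mem _
  | tmul a b => rw [sumMapSB_tmul]; exact mul_resL_resR_mem_schwartzBruhat e a.2 b.2
  | add s t hs ht => rw [map_add]; exact add_mem hs ht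

end Mul

section LocalField

open Literature.NumberTheory.GaloisRepresentations.IsNonarchimedeanLocalField

variable (K : Type*) [Field K] [ValuativeRel K] [TopologicalSpace K] [IsNonarchimedeanLocalField K]
  {ι₁ ι₂ ι : Type*} (e : ι₁ ⊕ ι₂ ≃ ι)

/-- membership in a box `(𝔭^N)^ι` splits along `e`. [cite: WeilBNT1967, Chap. II §2, Def. 2] -/
theorem mem_piPrimePowBall_iff_resL_resR {N : ℤ} (x : ι → K) :
    x ∈ piPrimePowBall K ι N ↔ resL e x ∈ piPrimePowBall K ι₁ N ∧ resR e x ∈ piPrimePowBall K ι₂ N := by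
  simp only [mem_piPrimePowBall_iff]
  exact forall_coord_iff e (Q := fun _ y => y ∈ primePowBall K N) x

/-- membership in a coset of a box splits along `e`. [cite: WeilBNT1967, Chap. II §2, Def. 2] -/
theorem mem_vadd_piPrimePowBall_iff_resL_resR {N : ℤ} (a v : ι → K) :
    v ∈ a +ᵥ piPrimePowBall K ι N ↔
      resL e v ∈ resL e a +ᵥ piPrimePowBall K ι₁ N ∧ resR e v ∈ resR e a +ᵥ piPrimePowBall K ι₂ N := by
  rw [mem_vadd_piPrimePowBall_iff, mem_vadd_piPrimePowBall_iff, mem_vadd_piPrimePowBall_iff,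
    mem_piPrimePowBall_iff_resL_resR K e, resL_sub, resR_sub]

/-- **the indicator of a coset of a box over `ι` is a product** `𝟙_{a|ι₁ + (𝔭^N)^{ι₁}} ⊠ 𝟙_{a|ι₂ + (𝔭^N)^{ι₂}}`.
[cite: WeilBNT1967, Chap. VII §2, Prop. 2] -/
theorem indicator_vadd_piPrimePowBall_eq_mul (N : ℤ) (a v : ι → K) :
    (a +ᵥ piPrimePowBall K ι N).indicator (fun _ => (1 : ℂ)) v =
      (resL e a +ᵥ piPrimePowBall K ι₁ N).indicator (fun _ => (1 : ℂ)) (resL e v) *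
        (resR e a +ᵥ piPrimePowBall K ι₂ N).indicator (fun _ => (1 : ℂ)) (resR e v) := by
  have h := mem_vadd_piPrimePowBall_iff_resL_resR K e (N := N) a v
  by_cases h₁ : resL e v ∈ resL e a +ᵥ piPrimePowBall K ι₁ N
  · by_cases h₂ : resR e v ∈ resR e a +ᵥ piPrimePowBall K ι₂ N
    · rw [Set.indicator_of_mem (h.2 ⟨h₁, h₂⟩), Set.indicator_of_mem h₁, Set.indicator_of_mem h₂, mul_one]
    · rw [Set.indicator_of_notMem (fun hv => h₂ (h.1 hv).2), Set.indicator_of_notMem h₂, mul_zero]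
  · rw [Set.indicator_of_notMem (fun hv => h₁ (h.1 hv).1), Set.indicator_of_notMem h₁, zero_mul]

variable [Fintype ι₁] [Fintype ι₂]

/-- … hence lies in the range of the multiplication map. [cite: WeilBNT1967, Chap. VII §2, Prop. 2] -/
theorem indicator_vadd_piPrimePowBall_mem_range_sumMapSB (N : ℤ) (a : ι → K) :
    (a +ᵥ piPrimePowBall K ι N).indicator (fun _ => (1 : ℂ)) ∈ LinearMap.range (sumMapSB K e) := by
  refine ⟨⟨_, indicator_vadd_piPrimePowBall_mem_schwartzBruhat N (resL e a) 1⟩ ⊗ₜ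
    ⟨_, indicator_vadd_piPrimePowBall_mem_schwartzBruhat N (resR e a) 1⟩, ?_⟩
  rw [sumMapSB_tmul]
  funext v
  exact (indicator_vadd_piPrimePowBall_eq_mul K e N a v).symm

/-- **the range of the multiplication map is exactly `𝒮(K^ι)`**: a finite place is EXACT for the algebraic
tensor product (step decomposition of [WeilBNT1967, VII §2 Prop. 2] + product of box indicators).
[cite: WeilBNT1967, Chap. VII §2, Prop. 2] -/
theorem range_sumMapSB [Fintype ι] : LinearMap.range (sumMapSB K e) = SchwartzBruhat (ι → K) := by
  refine le_antisymm (range_sumMapSB_le e) fun Φ hΦ => ?_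
  obtain ⟨N, C, rep, hrep, hsum⟩ := exists_finset_eq_sum_const_mul_indicator_pi hΦ
  have hΦeq : Φ = ∑ B ∈ C, Φ (rep B) • (rep B +ᵥ piPrimePowBall K ι N).indicator fun _ => (1 : ℂ) := by
    funext u
    rw [hsum u, Finset.sum_apply]
    refine Finset.sum_congr rfl fun B hB => ?_
    rw [Pi.smul_apply, smul_eq_mul, ← hrep B hB]
  rw [hΦeq]
  exact Submodule.sum_mem _ fun B _ =>
    Submodule.smul_mem _ _ (indicator_vadd_piPrimePowBall_mem_range_sumMapSB K e N (rep B))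

/-! ## §3 The isomorphism `𝒮(K^{ι₁}) ⊗ 𝒮(K^{ι₂}) ≅ 𝒮(K^ι)` and the products `f₁ ⊠ f₂` -/

variable [Fintype ι]

/-- **`𝒮(K^{ι₁}) ⊗_ℂ 𝒮(K^{ι₂}) ≅ 𝒮(K^ι)`** along `e`. [cite: WeilBNT1967, Chap. VII §2, Prop. 2] -/
def sumEquivSB : SchwartzBruhat (ι₁ → K) ⊗[ℂ] SchwartzBruhat (ι₂ → K) ≃ₗ[ℂ] SchwartzBruhat (ι → K) :=
  (LinearEquiv.ofInjective _ (sumMapSB_injective K e)).trans (LinearEquiv.ofEq _ _ (range_sumMapSB K e))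

/-- underlying function of `sumEquivSB t`. [cite: WeilBNT1967, Chap. VII §2, Prop. 2] -/
@[simp] theorem coe_sumEquivSB (t : SchwartzBruhat (ι₁ → K) ⊗[ℂ] SchwartzBruhat (ι₂ → K)) :
    ((sumEquivSB K e t : SchwartzBruhat (ι → K)) : (ι → K) → ℂ) = sumMapSB K e t := rfl

/-- **the product `f₁ ⊠ f₂ ∈ 𝒮(K^ι)`**, `(f₁ ⊠ f₂)(v) = f₁(v|ι₁) f₂(v|ι₂)` — the image of the pure tensor `f₁ ⊗ f₂`.
[cite: WeilBNT1967, Chap. VII §2, Prop. 2] -/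
def boxSB (f₁ : SchwartzBruhat (ι₁ → K)) (f₂ : SchwartzBruhat (ι₂ → K)) : SchwartzBruhat (ι → K) :=
  sumEquivSB K e (f₁ ⊗ₜ f₂)

/-- `f₁ ⊠ f₂ = sumEquivSB (f₁ ⊗ f₂)`. [cite: WeilBNT1967, Chap. VII §2, Prop. 2] -/
theorem sumEquivSB_tmul (f₁ : SchwartzBruhat (ι₁ → K)) (f₂ : SchwartzBruhat (ι₂ → K)) :
    sumEquivSB K e (f₁ ⊗ₜ f₂) = boxSB K e f₁ f₂ := rfl

/-- formula `(f₁ ⊠ f₂)(v) = f₁(v|ι₁) f₂(v|ι₂)`. [cite: WeilBNT1967, Chap. VII §2, Prop. 2] -/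
@[simp] theorem coe_boxSB (f₁ : SchwartzBruhat (ι₁ → K)) (f₂ : SchwartzBruhat (ι₂ → K)) :
    ((boxSB K e f₁ f₂ : SchwartzBruhat (ι → K)) : (ι → K) → ℂ) =
      fun v => (f₁ : (ι₁ → K) → ℂ) (resL e v) * (f₂ : (ι₂ → K) → ℂ) (resR e v) := by
  rw [boxSB, coe_sumEquivSB, sumMapSB_tmul]

/-- `(f₁ ⊠ f₂)(a ⊔ b) = f₁(a) f₂(b)`. [cite: WeilBNT1967, Chap. VII §2, Prop. 2] -/
theorem boxSB_apply_glue (f₁ : SchwartzBruhat (ι₁ → K)) (f₂ : SchwartzBruhat (ι₂ → K)) (a : ι₁ → K) (b : ι₂ → K) :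
    ((boxSB K e f₁ f₂ : SchwartzBruhat (ι → K)) : (ι → K) → ℂ) (glue e a b) =
      (f₁ : (ι₁ → K) → ℂ) a * (f₂ : (ι₂ → K) → ℂ) b := by
  simp only [coe_boxSB, resL_glue, resR_glue]

/-- `⊠` is additive on the left. [cite: WeilBNT1967, Chap. VII §2, Def. 1] -/
theorem boxSB_add_left (f₁ f₁' : SchwartzBruhat (ι₁ → K)) (f₂ : SchwartzBruhat (ι₂ → K)) :
    boxSB K e (f₁ + f₁') f₂ = boxSB K e f₁ f₂ + boxSB K e f₁' f₂ := by
  rw [boxSB, boxSB, boxSB, TensorProduct.add_tmul, map_add]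

/-- `⊠` is additive on the right. [cite: WeilBNT1967, Chap. VII §2, Def. 1] -/
theorem boxSB_add_right (f₁ : SchwartzBruhat (ι₁ → K)) (f₂ f₂' : SchwartzBruhat (ι₂ → K)) :
    boxSB K e f₁ (f₂ + f₂') = boxSB K e f₁ f₂ + boxSB K e f₁ f₂' := by
  rw [boxSB, boxSB, boxSB, TensorProduct.tmul_add, map_add]

/-- `⊠` is homogeneous on the left. [cite: WeilBNT1967, Chap. VII §2, Def. 1] -/
theorem boxSB_smul_left (c : ℂ) (f₁ : SchwartzBruhat (ι₁ → K)) (f₂ : SchwartzBruhat (ι₂ → K)) :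
    boxSB K e (c • f₁) f₂ = c • boxSB K e f₁ f₂ := by
  rw [boxSB, boxSB, ← TensorProduct.smul_tmul', map_smul]

/-- `⊠` is homogeneous on the right. [cite: WeilBNT1967, Chap. VII §2, Def. 1] -/
theorem boxSB_smul_right (c : ℂ) (f₁ : SchwartzBruhat (ι₁ → K)) (f₂ : SchwartzBruhat (ι₂ → K)) :
    boxSB K e f₁ (c • f₂) = c • boxSB K e f₁ f₂ := by
  rw [boxSB, boxSB, TensorProduct.tmul_smul, map_smul]

/-- `0 ⊠ f₂ = 0`. [cite: WeilBNT1967, Chap. VII §2, Def. 1] -/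
@[simp] theorem boxSB_zero_left (f₂ : SchwartzBruhat (ι₂ → K)) : boxSB K e 0 f₂ = 0 := by
  rw [boxSB, TensorProduct.zero_tmul, map_zero]

/-- `f₁ ⊠ 0 = 0`. [cite: WeilBNT1967, Chap. VII §2, Def. 1] -/
@[simp] theorem boxSB_zero_right (f₁ : SchwartzBruhat (ι₁ → K)) : boxSB K e f₁ 0 = 0 := by
  rw [boxSB, TensorProduct.tmul_zero, map_zero]

/-- every product function IS `f₁ ⊠ f₂` (as an element of `𝒮(K^ι)`). [cite: WeilBNT1967, Chap. VII §2, Prop. 2] -/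
theorem sumEquivSB_symm_boxSB (f₁ : SchwartzBruhat (ι₁ → K)) (f₂ : SchwartzBruhat (ι₂ → K)) :
    (sumEquivSB K e).symm (boxSB K e f₁ f₂) = f₁ ⊗ₜ f₂ :=
  (sumEquivSB K e).symm_apply_apply _

/-- **extensionality on products**: two linear maps out of `𝒮(K^ι)` that agree on all `f₁ ⊠ f₂` are equal.
[cite: WeilBNT1967, Chap. VII §2, Prop. 2] -/
theorem linearMap_ext_boxSB {M : Type*} [AddCommMonoid M] [Module ℂ M] {A B : SchwartzBruhat (ι → K) →ₗ[ℂ] M}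
    (h : ∀ (f₁ : SchwartzBruhat (ι₁ → K)) (f₂ : SchwartzBruhat (ι₂ → K)), A (boxSB K e f₁ f₂) = B (boxSB K e f₁ f₂)) :
    A = B := by
  have hc : A ∘ₗ (sumEquivSB K e).toLinearMap = B ∘ₗ (sumEquivSB K e).toLinearMap :=
    TensorProduct.ext' fun f₁ f₂ => h f₁ f₂
  refine LinearMap.ext fun Φ => ?_
  have := LinearMap.congr_fun hc ((sumEquivSB K e).symm Φ)
  simpa only [LinearMap.coe_comp, Function.comp_apply, LinearEquiv.coe_coe, LinearEquiv.apply_symm_apply] using this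

/-- **`⊠ f₂`-cancellation**: `f₁ ⊠ f₂ = f₁' ⊠ f₂` with `f₂ ≠ 0` forces `f₁ = f₁'` (read at a point where `f₂ ≠ 0`).
[cite: WeilBNT1967, Chap. VII §2, Def. 1] -/
theorem boxSB_left_cancel {f₂ : SchwartzBruhat (ι₂ → K)} (hf₂ : f₂ ≠ 0) {f₁ f₁' : SchwartzBruhat (ι₁ → K)}
    (h : boxSB K e f₁ f₂ = boxSB K e f₁' f₂) : f₁ = f₁' := by
  have hne : ((f₂ : SchwartzBruhat (ι₂ → K)) : (ι₂ → K) → ℂ) ≠ 0 := fun h0 =>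
    hf₂ (Subtype.ext (h0.trans (Submodule.coe_zero (R := ℂ) (M := (ι₂ → K) → ℂ)).symm))
  obtain ⟨b, hb⟩ := Function.ne_iff.1 hne
  apply Subtype.ext
  funext a
  have := congrArg (fun Ψ : SchwartzBruhat (ι → K) => ((Ψ : SchwartzBruhat (ι → K)) : (ι → K) → ℂ) (glue e a b)) h
  simp only [boxSB_apply_glue] at this
  exact mul_right_cancel₀ hb this

/-- `f₁ ⊠ f₂ ≠ 0` for `f₁, f₂ ≠ 0`. [cite: WeilBNT1967, Chap. VII §2, Def. 1] -/
theorem boxSB_ne_zero {f₁ : SchwartzBruhat (ι₁ → K)} {f₂ : SchwartzBruhat (ι₂ → K)} (hf₁ : f₁ ≠ 0) (hf₂ : f₂ ≠ 0) :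
    boxSB K e f₁ f₂ ≠ 0 := fun h => hf₁ (boxSB_left_cancel K e hf₂ (h.trans (boxSB_zero_left K e f₂).symm))

/-- there are non-zero Schwartz–Bruhat functions on `K^{ι₂}` (e.g. `1_{𝒪^{ι₂}}`). [cite: WeilBNT1967, Chap. VII §2, Def. 1] -/
theorem exists_schwartzBruhat_pi_ne_zero (ι₂ : Type*) [Fintype ι₂] : ∃ f₂ : SchwartzBruhat (ι₂ → K), f₂ ≠ 0 := by
  refine ⟨⟨(piPrimePowBall K ι₂ 0).indicator fun _ => (1 : ℂ), indicator_piPrimePowBall_mem_schwartzBruhat 0 1⟩,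
    fun h => ?_⟩
  have h0 := congrArg (fun Ψ : SchwartzBruhat (ι₂ → K) => ((Ψ : SchwartzBruhat (ι₂ → K)) : (ι₂ → K) → ℂ) 0) h
  simp only [Set.indicator_of_mem (zero_mem_piPrimePowBall (F := K) (ι := ι₂) 0), ZeroMemClass.coe_zero,
    Pi.zero_apply, one_ne_zero] at h0

/-! ## §4 Product operators `B₁ ⊠ B₂` on `𝒮(K^ι)` -/

/-- **the product operator** `B₁ ⊠ B₂` of linear endomorphisms of the factors, as a linear endomorphism of `𝒮(K^ι)`
(transport of `TensorProduct.map B₁ B₂` along `sumEquivSB`). [cite: MoeglinVignerasWaldspurger1987, Chap. 2 II.1 Rem. (6)] -/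
def sumEndSB (B₁ : SchwartzBruhat (ι₁ → K) →ₗ[ℂ] SchwartzBruhat (ι₁ → K))
    (B₂ : SchwartzBruhat (ι₂ → K) →ₗ[ℂ] SchwartzBruhat (ι₂ → K)) :
    SchwartzBruhat (ι → K) →ₗ[ℂ] SchwartzBruhat (ι → K) :=
  (sumEquivSB K e).toLinearMap ∘ₗ TensorProduct.map B₁ B₂ ∘ₗ (sumEquivSB K e).symm.toLinearMap

/-- `(B₁ ⊠ B₂)(f₁ ⊠ f₂) = B₁ f₁ ⊠ B₂ f₂`. [cite: MoeglinVignerasWaldspurger1987, Chap. 2 II.1 Rem. (6)] -/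
@[simp] theorem sumEndSB_boxSB (B₁ : SchwartzBruhat (ι₁ → K) →ₗ[ℂ] SchwartzBruhat (ι₁ → K))
    (B₂ : SchwartzBruhat (ι₂ → K) →ₗ[ℂ] SchwartzBruhat (ι₂ → K))
    (f₁ : SchwartzBruhat (ι₁ → K)) (f₂ : SchwartzBruhat (ι₂ → K)) :
    sumEndSB K e B₁ B₂ (boxSB K e f₁ f₂) = boxSB K e (B₁ f₁) (B₂ f₂) := by
  simp only [sumEndSB, boxSB, LinearMap.coe_comp, Function.comp_apply, LinearEquiv.coe_coe,
    LinearEquiv.symm_apply_apply, TensorProduct.map_tmul]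

/-- `sumEndSB` read on the algebraic tensor product is `TensorProduct.map`. [cite: MoeglinVignerasWaldspurger1987, Chap. 2 II.1 Rem. (6)] -/
theorem sumEquivSB_symm_sumEndSB (B₁ : SchwartzBruhat (ι₁ → K) →ₗ[ℂ] SchwartzBruhat (ι₁ → K))
    (B₂ : SchwartzBruhat (ι₂ → K) →ₗ[ℂ] SchwartzBruhat (ι₂ → K)) (Φ : SchwartzBruhat (ι → K)) :
    (sumEquivSB K e).symm (sumEndSB K e B₁ B₂ Φ) = TensorProduct.map B₁ B₂ ((sumEquivSB K e).symm Φ) := by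
  simp only [sumEndSB, LinearMap.coe_comp, Function.comp_apply, LinearEquiv.coe_coe, LinearEquiv.symm_apply_apply]

/-- `1 ⊠ 1 = 1`. [cite: MoeglinVignerasWaldspurger1987, Chap. 2 II.1 Rem. (6)] -/
theorem sumEndSB_id : sumEndSB K e LinearMap.id LinearMap.id = (LinearMap.id : SchwartzBruhat (ι → K) →ₗ[ℂ] _) := by
  apply linearMap_ext_boxSB K e
  intro f₁ f₂
  rw [sumEndSB_boxSB]
  rfl

/-- **functoriality**: `(B₁ ∘ B₁') ⊠ (B₂ ∘ B₂') = (B₁ ⊠ B₂) ∘ (B₁' ⊠ B₂')`. [cite: MoeglinVignerasWaldspurger1987, Chap. 2 II.1 Rem. (6)] -/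
theorem sumEndSB_comp (B₁ B₁' : SchwartzBruhat (ι₁ → K) →ₗ[ℂ] SchwartzBruhat (ι₁ → K))
    (B₂ B₂' : SchwartzBruhat (ι₂ → K) →ₗ[ℂ] SchwartzBruhat (ι₂ → K)) :
    sumEndSB K e (B₁ ∘ₗ B₁') (B₂ ∘ₗ B₂') = sumEndSB K e B₁ B₂ ∘ₗ sumEndSB K e B₁' B₂' := by
  apply linearMap_ext_boxSB K e
  intro f₁ f₂
  simp only [sumEndSB_boxSB, LinearMap.coe_comp, Function.comp_apply]

end LocalField

end Literature.NumberTheory.Automorphic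

end
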